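import Literature.NumberTheory.GaloisRepresentations.CubicResidueSymbol
import HarnessLib

/-!
# Cubic reciprocity with a rational prime `q ≡ 2 (mod 3)` (Eisenstein), by Gauss sums

Topic `Literature/NumberTheory/GaloisRepresentations` (next to `CubicResidueSymbol.lean`, whose
symbol `χ_𝔭 = (·/𝔭)₃ : 𝓞 K ⧸ 𝔭 → 𝓞 K` — Ireland–Rosen, Ch. 9 §3 — this file continues); namespace
`Literature.NumberTheory.GaloisRepresentations`. Everything here is PROVED (no `sorry`, no named
fact); the only definition is the Jacobi sum `cubicJacobiSum hζ 𝔭 h3 = J(χ_𝔭, χ_𝔭) ∈ 𝓞 K`.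

Source: K. Ireland, M. Rosen, *A Classical Introduction to Modern Number Theory*, Ch. 9 §4 "Proof of
the Law of Cubic Reciprocity" (Theorem 1 of Ch. 9 §3), PDF pp. 123–124 of the held copy
(`book:ireland1982-classical-introduction-modern-number-theory`): "(a) `g(χ)³ = p J(χ, χ)`" (corollary
to Prop. 8.3.3); Lemma 1 "`J(χ_π, χ_π) = π`" for `π` primary, proved from "`J(χ_π, χ_π) ≡ Σ_x
x^{(p-1)/3}(1-x)^{(p-1)/3} ≡ 0 (π)`" (degree `2(p-1)/3 < p - 1`) and "`J J̄ = p`"; and the case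
"`π₁ = q ≡ 2 (3)`, `π₂ = π`" of the proof of Theorem 1: "`g(χ_π)^{q²-1} = (pπ)^{(q²-1)/3}`",
"`g(χ_π)^{q²-1} ≡ χ_q(pπ) (q)`", "`g(χ_π)^{q²} ≡ g_{q²}(χ_π) (q)`" (eqs. (1), (2)),
"`g_{q²}(χ_π) = χ_π(q^{-2}) g(χ_π) = χ_π(q) g(χ_π)`" (Prop. 8.2.1), whence "`χ_π(q) = χ_q(π)`".

We work over a number field `K` containing a primitive cube root of unity `ζ ∈ 𝓞 K` (the intended
case is `K = ℚ(ω)`, `𝓞 K = ℤ[ω]`), at a finite place `𝔭 ∤ 3q` with residue field `F = 𝓞 K ⧸ 𝔭`, and at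
a finite place `𝔮 ∋ q` with `N𝔮 = q²` (for `ℚ(ω)`: the inert prime `q ℤ[ω]`). The Gauss sums live in a
ring of characteristic `q` (a cyclotomic extension of the residue field of `𝔮`), so that the
congruences "`mod q`" of the printed proof are identities, and Frobenius is the `q`-th power map.

* `cubicJacobiSum hζ 𝔭 h3 = J(χ_𝔭, χ_𝔭) = Σ_t χ_𝔭(t) χ_𝔭(1 - t) ∈ 𝓞 K`.
* `cubicResidueSymbol_natCast_eq_cubicResidueSymbol_cubicJacobiSum` — **Eisenstein's reciprocity
  step, Jacobi-sum form: `χ_𝔭(q) = χ_𝔮(J(χ_𝔭, χ_𝔭))`** for every prime `q ≡ 2 (mod 3)`, every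
  `𝔭 ∤ 3q` and every `𝔮 ∋ q` with `N𝔮 = q²`. Proof (Ireland–Rosen's): in characteristic `q`,
  `g³ = #F · J` (`gaussSum_pow_eq_prod_jacobiSum`), `g^{q²} = χ_𝔭(q²)⁻¹ g` (Frobenius twice,
  `gaussSum_frob`, `gaussSum_mulShift`), `g ≠ 0`; so `χ_𝔭(q²) (#F · J)^{(q²-1)/3} = 1`, and
  `x^{(q²-1)/3} ≡ χ_𝔮(x) (mod 𝔮)` (`cubicResidueSymbol_spec`), `χ_𝔮(#F) = 1` (`#F = p^f` is rational,
  `3 ∣ q + 1`), `χ_𝔭(q²)⁻¹ = χ_𝔭(q)`; finally distinct cube roots of unity stay distinct mod `𝔮 ∤ 3`.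
* `cubicJacobiSum_mem` — `J(χ_𝔭, χ_𝔭) ∈ 𝔭` (the power sums `Σ_t t^a (1-t)^a`, `0 < 2a < #F - 1`,
  vanish).

* For `K = ℚ(ω)` (`IsCyclotomicExtension {3} ℚ K`): `span_cubicJacobiSum_eq` — **`(J(χ_𝔭, χ_𝔭)) = 𝔭`**
  (`J ∈ 𝔭`, `J · J(χ², χ²) = N𝔭` from Mathlib's `jacobiSum_mul_jacobiSum_inv`, and the non-trivial
  automorphism maps `J` to `J(χ², χ²)`, so `N_{K/ℚ}(J) = N𝔭`); `cubicResidueSymbol_unit_eq_one` —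
  every unit is a cubic residue mod `𝔮` when `9 ∣ N𝔮 - 1`; and
  `cubicResidueSymbol_natCast_eq_cubicResidueSymbol_generator` — **for `q ≡ 8 (mod 9)` and ANY
  generator `π` of a principal `𝔭 ∤ 3q`: `χ_𝔭(q) = χ_𝔮(π)`**, "`(q/π)₃ = (π/q)₃`" (the form used for the
  product formula of the cubic Hilbert symbols `(·, q)_𝔭` over `ℚ(ω)` in Cassels 1964).

Not here: the full law of cubic reciprocity between two primes of `ℤ[ω]` (Ireland–Rosen Ch. 9 Thm. 1,
which needs primary normalisations and `J(χ_π, χ_π) = π` on the nose).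

## References

* K. Ireland, M. Rosen, *A Classical Introduction to Modern Number Theory*, GTM 84, Springer 1982,
  Ch. 8 §2 Prop. 8.2.1, §3 Prop. 8.3.3 and Cor.; Ch. 9 §3 Props. 9.3.1–9.3.5 and Theorem 1; §4 Lemma 1,
  Corollary (`g(χ_π)³ = pπ`) and the proof of Theorem 1 (PDF pp. 122–124). [IrelandRosen1982]
* G. Eisenstein, *Beweis des Reciprocitätssatzes für die cubischen Reste in der Theorie der aus
  dritten Wurzeln der Einheit zusammengesetzten complexen Zahlen*, J. reine angew. Math. 27 (1844),
  289–310. [cited through IrelandRosen1982]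
-/

noncomputable section

namespace Literature.NumberTheory.GaloisRepresentations

open NumberField IsDedekindDomain

variable {K : Type*} [Field K] [NumberField K]
variable {ζ : 𝓞 K} (hζ : IsPrimitiveRoot ζ 3)

/-! ### The cubic Jacobi sum `J(χ_𝔭, χ_𝔭)` -/

section JacobiSum

include hζ in
/-- **The Jacobi sum `J(χ_𝔭, χ_𝔭) = Σ_{t ∈ 𝓞 K/𝔭} χ_𝔭(t) χ_𝔭(1 - t) ∈ 𝓞 K`** of the cubic residue
character at a finite place `𝔭 ∤ 3` (Ireland–Rosen Ch. 8 §3, with the character of Ch. 9 §3).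
[cite: IrelandRosen1982, Ch. 8 §3 Definition] -/
def cubicJacobiSum (𝔭 : HeightOneSpectrum (𝓞 K)) (h3 : (3 : 𝓞 K) ∉ 𝔭.asIdeal) : 𝓞 K :=
  letI := Fintype.ofFinite (𝓞 K ⧸ 𝔭.asIdeal)
  jacobiSum (cubicResidueChar hζ 𝔭 h3) (cubicResidueChar hζ 𝔭 h3)

/-- Unfolding lemma for `cubicJacobiSum` (any `Fintype` instance on the residue ring). [folklore] -/
theorem cubicJacobiSum_eq (𝔭 : HeightOneSpectrum (𝓞 K)) (h3 : (3 : 𝓞 K) ∉ 𝔭.asIdeal)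
    [Fintype (𝓞 K ⧸ 𝔭.asIdeal)] :
    cubicJacobiSum hζ 𝔭 h3 = jacobiSum (cubicResidueChar hζ 𝔭 h3) (cubicResidueChar hζ 𝔭 h3) := by
  unfold cubicJacobiSum
  congr
  apply Subsingleton.elim

end JacobiSum

/-! ### Auxiliary facts on the residue fields -/

section Residue

/-- A finite place containing the rational prime `q ≠ 3`... more precisely: if `q ∈ 𝔮` and `q` is
prime to `3`, then `𝔮 ∤ 3`. [folklore] -/
theorem three_not_mem_of_natCast_mem {𝔮 : HeightOneSpectrum (𝓞 K)} {q : ℕ} (hq : (q : 𝓞 K) ∈ 𝔮.asIdeal)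
    (hq3 : Nat.Coprime q 3) : (3 : 𝓞 K) ∉ 𝔮.asIdeal := by
  intro h3
  obtain ⟨a, b, hab⟩ := Nat.isCoprime_iff_coprime.mpr hq3
  have h1 : (1 : 𝓞 K) ∈ 𝔮.asIdeal := by
    have e : (1 : 𝓞 K) = (a : 𝓞 K) * q + (b : 𝓞 K) * 3 := by exact_mod_cast hab.symm
    rw [e]
    exact 𝔮.asIdeal.add_mem (𝔮.asIdeal.mul_mem_left _ hq) (𝔮.asIdeal.mul_mem_left _ h3)
  exact 𝔮.isPrime.ne_top ((Ideal.eq_top_iff_one _).mpr h1)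

/-- If the rational prime `q` lies in `𝔮`, the residue field `𝓞 K ⧸ 𝔮` has characteristic `q`. [folklore] -/
theorem charP_quotient_of_natCast_mem {𝔮 : HeightOneSpectrum (𝓞 K)} {q : ℕ} [hq : Fact q.Prime]
    (hq𝔮 : (q : 𝓞 K) ∈ 𝔮.asIdeal) : CharP (𝓞 K ⧸ 𝔮.asIdeal) q := by
  letI := Ideal.Quotient.field 𝔮.asIdeal
  refine (CharP.charP_iff_prime_eq_zero hq.out).mpr ?_
  rw [← map_natCast (Ideal.Quotient.mk 𝔮.asIdeal), Ideal.Quotient.eq_zero_iff_mem]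
  exact hq𝔮

/-- A natural number prime to `q ∈ 𝔮` is a unit of the residue field: `n^{q-1} = 1` there
(Fermat in the prime field `ℤ/q ⊆ 𝓞 K/𝔮`). [folklore] -/
theorem natCast_pow_sub_one_eq_one {𝔮 : HeightOneSpectrum (𝓞 K)} {q : ℕ} [hq : Fact q.Prime]
    (hq𝔮 : (q : 𝓞 K) ∈ 𝔮.asIdeal) {n : ℕ} (hn : ¬ q ∣ n) :
    ((n : 𝓞 K ⧸ 𝔮.asIdeal)) ^ (q - 1) = 1 := by
  haveI := charP_quotient_of_natCast_mem (K := K) hq𝔮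
  have h := ZMod.pow_card_sub_one_eq_one (p := q) (a := (n : ZMod q))
    (by rwa [Ne, ZMod.natCast_eq_zero_iff])
  have h' := congrArg (ZMod.castHom (dvd_refl q) (𝓞 K ⧸ 𝔮.asIdeal)) h
  rwa [map_pow, map_natCast, map_one] at h'

end Residue

/-! ### Eisenstein's reciprocity step -/

section Reciprocity

variable {q : ℕ} [hq : Fact q.Prime]

include hζ hq in
/-- **Cubic reciprocity with a rational prime, Jacobi-sum form** (Eisenstein; Ireland–Rosen Ch. 9
§4, proof of Thm. 1, the case of a rational prime `q ≡ 2 (mod 3)`). Let `K ∋ ζ` (a primitive cube root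
of unity in `𝓞 K`), `q ≡ 2 (mod 3)` a rational prime, `𝔮` a finite place of `K` with `q ∈ 𝔮` and
`N𝔮 = q²`, and `𝔭 ∤ 3q` a finite place. Then
`χ_𝔭(q) = χ_𝔮(J(χ_𝔭, χ_𝔭))`,
i.e. the cubic residue symbol of `q` at `𝔭` equals that of the Jacobi sum `J(χ_𝔭, χ_𝔭) ∈ 𝓞 K` at `𝔮`.
(For `K = ℚ(ω)` and `𝔭 = (π)`, `π` primary of norm `p ≡ 1 (mod 3)`, one has `J(χ_π, χ_π) = π`, and this
is Ireland–Rosen's "`χ_π(q) = χ_q(π)`".) [cite: IrelandRosen1982, Ch. 9 §4, proof of Theorem 1, case π₁ = q ≡ 2 (3) (eqs. (1)–(2))] -/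
theorem cubicResidueSymbol_natCast_eq_cubicResidueSymbol_cubicJacobiSum (hq3 : q % 3 = 2)
    {𝔮 : HeightOneSpectrum (𝓞 K)} (hq𝔮 : (q : 𝓞 K) ∈ 𝔮.asIdeal) (h𝔮 : 𝔮.residueCard = q ^ 2)
    {𝔭 : HeightOneSpectrum (𝓞 K)} (h3 : (3 : 𝓞 K) ∉ 𝔭.asIdeal) (hq𝔭 : (q : 𝓞 K) ∉ 𝔭.asIdeal) :
    cubicResidueSymbol 𝔭 (q : 𝓞 K ⧸ 𝔭.asIdeal) =
      cubicResidueSymbol 𝔮 (Ideal.Quotient.mk 𝔮.asIdeal (cubicJacobiSum hζ 𝔭 h3)) := by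
  classical
  -- residue fields: `F = 𝓞 K ⧸ 𝔭` (characteristic `p ≠ q`) and `k = 𝓞 K ⧸ 𝔮` (characteristic `q`)
  letI := Ideal.Quotient.field 𝔭.asIdeal
  letI := Fintype.ofFinite (𝓞 K ⧸ 𝔭.asIdeal)
  letI := Ideal.Quotient.field 𝔮.asIdeal
  haveI hchark : CharP (𝓞 K ⧸ 𝔮.asIdeal) q := charP_quotient_of_natCast_mem (K := K) hq𝔮
  have hq3' : Nat.Coprime q 3 := by
    rw [Nat.coprime_comm, Nat.Prime.coprime_iff_not_dvd (by norm_num)]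
    omega
  have h3𝔮 : (3 : 𝓞 K) ∉ 𝔮.asIdeal := three_not_mem_of_natCast_mem hq𝔮 hq3'
  -- the characteristic `p` of `F` is not `q`
  have hpF : ringChar (𝓞 K ⧸ 𝔭.asIdeal) ≠ q := by
    intro h
    haveI : CharP (𝓞 K ⧸ 𝔭.asIdeal) q := h ▸ (inferInstance : CharP (𝓞 K ⧸ 𝔭.asIdeal) (ringChar _))
    have h0 : ((q : 𝓞 K) : 𝓞 K ⧸ 𝔭.asIdeal) = 0 := by exact_mod_cast CharP.cast_eq_zero (𝓞 K ⧸ 𝔭.asIdeal) q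
    exact hq𝔭 ((Ideal.Quotient.eq_zero_iff_mem).mp h0)
  have hringk : ringChar (𝓞 K ⧸ 𝔮.asIdeal) = q := ringChar.eq _ q
  have hchar_ne : ringChar (𝓞 K ⧸ 𝔮.asIdeal) ≠ ringChar (𝓞 K ⧸ 𝔭.asIdeal) := by
    rw [hringk]; exact hpF.symm
  -- a primitive additive character `ψ` of `F` with values in `R = CyclotomicField n k`, char `q`
  set Ψ := AddChar.FiniteField.primitiveChar (𝓞 K ⧸ 𝔭.asIdeal) (𝓞 K ⧸ 𝔮.asIdeal) hchar_ne with hΨdef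
  haveI hcharR : CharP (CyclotomicField Ψ.n (𝓞 K ⧸ 𝔮.asIdeal)) q :=
    charP_of_injective_algebraMap (algebraMap (𝓞 K ⧸ 𝔮.asIdeal) (CyclotomicField Ψ.n (𝓞 K ⧸ 𝔮.asIdeal))).injective q
  set ψ : AddChar (𝓞 K ⧸ 𝔭.asIdeal) (CyclotomicField Ψ.n (𝓞 K ⧸ 𝔮.asIdeal)) := Ψ.char with hψdef
  have hψ : ψ.IsPrimitive := Ψ.prim
  -- the cubic character, pushed to `R`
  set φ : 𝓞 K →+* CyclotomicField Ψ.n (𝓞 K ⧸ 𝔮.asIdeal) :=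
    (algebraMap (𝓞 K ⧸ 𝔮.asIdeal) _).comp (Ideal.Quotient.mk 𝔮.asIdeal) with hφdef
  set χ₀ := cubicResidueChar hζ 𝔭 h3 with hχ₀def
  set χ : MulChar (𝓞 K ⧸ 𝔭.asIdeal) (CyclotomicField Ψ.n (𝓞 K ⧸ 𝔮.asIdeal)) :=
    χ₀.ringHomComp φ with hχdef
  have hχapp : ∀ a : 𝓞 K ⧸ 𝔭.asIdeal, χ a = φ (cubicResidueSymbol 𝔭 a) := fun a ↦ rfl
  -- `φ` is injective on the cube roots of unity
  have hφζ : IsPrimitiveRoot (φ ζ) 3 :=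
    (isPrimitiveRoot_mk_of_three_not_mem hζ h3𝔮).map_of_injective
      (algebraMap (𝓞 K ⧸ 𝔮.asIdeal) (CyclotomicField Ψ.n (𝓞 K ⧸ 𝔮.asIdeal))).injective
  have hφinj : ∀ i j : ℕ, i < 3 → j < 3 → φ (ζ ^ i) = φ (ζ ^ j) → i = j := by
    intro i j hi hj h
    rw [map_pow, map_pow] at h
    exact hφζ.pow_inj hi hj h
  have hroots : ∀ μ : 𝓞 K, μ ^ 3 = 1 → φ μ = 1 → μ = 1 := by
    intro μ hμ h1
    obtain ⟨i, hi, rfl⟩ := hζ.eq_pow_of_pow_eq_one hμ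
    have h0 : φ (ζ ^ i) = φ (ζ ^ 0) := by rw [h1, pow_zero, map_one]
    rw [hφinj i 0 hi (by norm_num) h0, pow_zero]
  -- `χ` is a cubic character of order `3`
  have hχ3 : χ ^ 3 = 1 := by
    rw [hχdef, MulChar.ringHomComp_pow, hχ₀def, cubicResidueChar_pow_three hζ h3, MulChar.ringHomComp_one]
  have hχne : χ ≠ 1 := by
    -- a generator `g` of `Fˣ` has `χ₀ g ≠ 1`
    intro h1
    obtain ⟨g, hg⟩ := IsCyclic.exists_generator (α := (𝓞 K ⧸ 𝔭.asIdeal)ˣ)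
    have hg3 : cubicResidueSymbol 𝔭 (g : 𝓞 K ⧸ 𝔭.asIdeal) ≠ 1 := by
      intro hg1
      have hspec := (cubicResidueSymbol_spec hζ h3 (Units.ne_zero g)).2
      rw [hg1, map_one] at hspec
      -- `g^{(N𝔭-1)/3} = 1` contradicts `orderOf g = N𝔭 - 1`
      have hord : orderOf g = Fintype.card (𝓞 K ⧸ 𝔭.asIdeal) - 1 := by
        rw [orderOf_eq_card_of_forall_mem_zpowers hg, Nat.card_eq_fintype_card, Fintype.card_units]
      have hcardF : Fintype.card (𝓞 K ⧸ 𝔭.asIdeal) = 𝔭.residueCard := by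
        rw [HeightOneSpectrum.residueCard_eq_card_quotient, Nat.card_eq_fintype_card]
      have hdvd := orderOf_dvd_of_pow_eq_one (x := g) (n := (𝔭.residueCard - 1) / 3)
        (Units.ext (by rw [Units.val_pow_eq_pow_val, Units.val_one, ← hspec]))
      rw [hord, hcardF] at hdvd
      have hpos := residueCard_sub_one_div_three_ne_zero hζ h3 (𝔭 := 𝔭)
      have h3dvd := three_dvd_residueCard_sub_one hζ h3 (𝔭 := 𝔭)
      have hle := Nat.le_of_dvd (Nat.pos_of_ne_zero hpos) hdvd
      omega
    apply hg3
    apply hroots _ (cubicResidueSymbol_spec hζ h3 (Units.ne_zero g)).1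
    have := congrArg (fun χ' : MulChar (𝓞 K ⧸ 𝔭.asIdeal) (CyclotomicField Ψ.n (𝓞 K ⧸ 𝔮.asIdeal)) ↦
      χ' (g : 𝓞 K ⧸ 𝔭.asIdeal)) h1
    simpa only [hχapp, MulChar.one_apply_coe] using this
  have hordχ : orderOf χ = 3 := orderOf_eq_prime hχ3 hχne
  -- `χ(-1) = 1`
  have hχneg : χ (-1) = 1 := by
    have h1 : χ (-1) ^ 2 = 1 := by rw [← map_pow, neg_one_sq, map_one]
    have h2 : χ (-1) ^ 3 = 1 := by
      rw [← MulChar.pow_apply' χ three_ne_zero, hχ3, MulChar.one_apply isUnit_one.neg]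
    calc χ (-1) = χ (-1) * χ (-1) ^ 2 := by rw [h1, mul_one]
      _ = χ (-1) ^ 3 := by ring
      _ = 1 := h2
  -- the Gauss sum and its cube
  set g := gaussSum χ ψ with hgdef
  have hcardF0 : (Fintype.card (𝓞 K ⧸ 𝔭.asIdeal) : CyclotomicField Ψ.n (𝓞 K ⧸ 𝔮.asIdeal)) ≠ 0 := by
    intro h0
    obtain ⟨n, hp, hn⟩ := FiniteField.card (𝓞 K ⧸ 𝔭.asIdeal) (ringChar (𝓞 K ⧸ 𝔭.asIdeal))
    rw [hn, Nat.cast_pow, pow_eq_zero_iff (NeZero.ne _)] at h0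
    have hdvd : q ∣ ringChar (𝓞 K ⧸ 𝔭.asIdeal) :=
      (CharP.cast_eq_zero_iff (CyclotomicField Ψ.n (𝓞 K ⧸ 𝔮.asIdeal)) q _).mp h0
    exact hpF ((Nat.prime_dvd_prime_iff_eq hq.out hp).mp hdvd).symm
  have hg0 : g ≠ 0 := gaussSum_ne_zero_of_nontrivial hcardF0 hχne hψ
  have hg3 : g ^ 3 = (Fintype.card (𝓞 K ⧸ 𝔭.asIdeal) : CyclotomicField Ψ.n (𝓞 K ⧸ 𝔮.asIdeal)) *
      φ (cubicJacobiSum hζ 𝔭 h3) := by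
    have h := gaussSum_pow_eq_prod_jacobiSum (χ := χ) (ψ := ψ) (by rw [hordχ]; norm_num) hψ
    rw [hordχ] at h
    rw [hgdef, h, hχneg, one_mul, show (3 - 1 : ℕ) = 2 from rfl, show Finset.Ico 1 2 = {1} from rfl,
      Finset.prod_singleton, pow_one, cubicJacobiSum_eq, hχdef, ← jacobiSum_ringHomComp]
  -- Frobenius twice: `χ(q²) g^{q²} = g`
  have hqF : IsUnit ((q : 𝓞 K ⧸ 𝔭.asIdeal)) := by
    rw [isUnit_iff_ne_zero]
    intro h0
    have : ((q : 𝓞 K) : 𝓞 K ⧸ 𝔭.asIdeal) = 0 := by exact_mod_cast h0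
    exact hq𝔭 ((Ideal.Quotient.eq_zero_iff_mem).mp this)
  have hfrob : χ ((q : 𝓞 K ⧸ 𝔭.asIdeal) ^ 2) * g ^ (q ^ 2) = g := by
    have h1 : g ^ (q ^ 2) = gaussSum (χ ^ (q ^ 2)) (ψ ^ (q ^ 2)) := by
      rw [pow_two q, pow_mul, hgdef, gaussSum_frob q χ ψ, gaussSum_frob q, ← pow_mul, ← pow_mul]
    have h2 : χ ^ (q ^ 2) = χ := by
      rw [← pow_mod_orderOf, hordχ]
      have : q ^ 2 % 3 = 1 := by
        rw [Nat.pow_mod, hq3]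
      rw [this, pow_one]
    have h3' : ψ ^ (q ^ 2) = ψ.mulShift ((q : 𝓞 K ⧸ 𝔭.asIdeal) ^ 2) := by
      rw [AddChar.pow_mulShift]; push_cast; rfl
    rw [h1, h2, h3', ← (hqF.pow 2).unit_spec, gaussSum_mulShift]
  -- hence `χ(q²) (g³)^{(q²-1)/3} = 1`
  have h3q : 3 ∣ q ^ 2 - 1 := by
    have : q ^ 2 % 3 = 1 := by rw [Nat.pow_mod, hq3]
    omega
  have hq1 : 1 ≤ q ^ 2 := Nat.one_le_pow _ _ hq.out.pos
  have hmain : χ ((q : 𝓞 K ⧸ 𝔭.asIdeal) ^ 2) * (g ^ 3) ^ ((q ^ 2 - 1) / 3) = 1 := by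
    have e : g ^ (q ^ 2) = (g ^ 3) ^ ((q ^ 2 - 1) / 3) * g := by
      rw [← pow_mul, Nat.mul_div_cancel' h3q, ← pow_succ, Nat.sub_add_cancel hq1]
    rw [e, ← mul_assoc] at hfrob
    exact mul_right_cancel₀ hg0 (hfrob.trans (one_mul g).symm)
  -- the right-hand side modulo `𝔮`: `x^{(q²-1)/3} ≡ χ_𝔮(x)`
  set J := cubicJacobiSum hζ 𝔭 h3 with hJdef
  set x : 𝓞 K := (Fintype.card (𝓞 K ⧸ 𝔭.asIdeal) : 𝓞 K) * J with hxdef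
  have hxφ : (Fintype.card (𝓞 K ⧸ 𝔭.asIdeal) : CyclotomicField Ψ.n (𝓞 K ⧸ 𝔮.asIdeal)) * φ J = φ x := by
    rw [hxdef, map_mul, map_natCast]
  have hx0 : Ideal.Quotient.mk 𝔮.asIdeal x ≠ 0 := by
    intro h0
    have : φ x = 0 := by rw [hφdef, RingHom.comp_apply, h0, map_zero]
    rw [← hxφ, ← hg3] at this
    exact hg0 (pow_eq_zero_iff (by norm_num) |>.mp this)
  have hexp : (𝔮.residueCard - 1) / 3 = (q ^ 2 - 1) / 3 := by rw [h𝔮]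
  obtain ⟨hx3, hxspec⟩ := cubicResidueSymbol_spec hζ h3𝔮 hx0
  rw [hexp] at hxspec
  have hφx : φ (cubicResidueSymbol 𝔮 (Ideal.Quotient.mk 𝔮.asIdeal x)) = (g ^ 3) ^ ((q ^ 2 - 1) / 3) := by
    rw [hg3, hxφ, hφdef, RingHom.comp_apply, hxspec, map_pow, ← RingHom.comp_apply]
  -- `χ_𝔮(x) = χ_𝔮(#F) χ_𝔮(J) = χ_𝔮(J)`
  have hcardF' : ((Fintype.card (𝓞 K ⧸ 𝔭.asIdeal) : 𝓞 K) : 𝓞 K ⧸ 𝔮.asIdeal) ≠ 0 := by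
    intro h0
    apply hx0
    rw [hxdef, map_mul, map_natCast]
    rw [map_natCast] at h0
    rw [h0, zero_mul]
  have hcardsym : cubicResidueSymbol 𝔮 ((Fintype.card (𝓞 K ⧸ 𝔭.asIdeal) : 𝓞 K) : 𝓞 K ⧸ 𝔮.asIdeal) = 1 := by
    obtain ⟨n, hp, hn⟩ := FiniteField.card (𝓞 K ⧸ 𝔭.asIdeal) (ringChar (𝓞 K ⧸ 𝔭.asIdeal))
    haveI : Fact (ringChar (𝓞 K ⧸ 𝔭.asIdeal)).Prime := ⟨hp⟩
    have hndvd : ¬ q ∣ ringChar (𝓞 K ⧸ 𝔭.asIdeal) := fun hdvd ↦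
      hpF ((Nat.prime_dvd_prime_iff_eq hq.out hp).mp hdvd).symm
    refine cubicResidueSymbol_eq_of_pow_three_eq_one hζ h3𝔮 (one_pow 3) ?_
    rw [map_one, hexp, map_natCast, hn, Nat.cast_pow, ← pow_mul]
    -- `(q² - 1)/3 = (q - 1) · ((q + 1)/3)`
    have h3q1 : 3 ∣ q + 1 := by omega
    have e : (n : ℕ) * ((q ^ 2 - 1) / 3) = (q - 1) * (n * ((q + 1) / 3)) := by
      have h1 : q ^ 2 - 1 = (q - 1) * (q + 1) := by
        have := hq.out.one_le
        zify [this, hq1]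
        ring
      rw [h1, Nat.mul_div_assoc _ h3q1]
      ring
    rw [e, pow_mul, natCast_pow_sub_one_eq_one hq𝔮 hndvd, one_pow]
  have hJsym : cubicResidueSymbol 𝔮 (Ideal.Quotient.mk 𝔮.asIdeal x) =
      cubicResidueSymbol 𝔮 (Ideal.Quotient.mk 𝔮.asIdeal J) := by
    rw [hxdef, map_mul, cubicResidueSymbol_mul hζ, hcardsym, one_mul]
  -- `χ_𝔭(q²) = χ_𝔭(q)⁻¹`, as elements of `𝓞 K`
  have hqF0 : ((q : 𝓞 K ⧸ 𝔭.asIdeal)) ≠ 0 := hqF.ne_zero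
  obtain ⟨hq3cube, -⟩ := cubicResidueSymbol_spec hζ h3 hqF0
  have hsq : cubicResidueSymbol 𝔭 ((q : 𝓞 K ⧸ 𝔭.asIdeal) ^ 2) * cubicResidueSymbol 𝔭 (q : 𝓞 K ⧸ 𝔭.asIdeal) = 1 := by
    rw [← cubicResidueSymbol_mul hζ, ← pow_succ, ← cubicResidueChar_apply hζ h3, map_pow,
      cubicResidueChar_apply, hq3cube]
  -- assemble: `φ (χ_𝔭(q²) χ_𝔮(J)) = 1`, both cube roots of unity
  have hprod3 : (cubicResidueSymbol 𝔭 ((q : 𝓞 K ⧸ 𝔭.asIdeal) ^ 2) *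
      cubicResidueSymbol 𝔮 (Ideal.Quotient.mk 𝔮.asIdeal x)) ^ 3 = 1 := by
    obtain ⟨h1, -⟩ := cubicResidueSymbol_spec hζ h3 (pow_ne_zero 2 hqF0)
    rw [mul_pow, h1, hx3, one_mul]
  have hprodφ : φ (cubicResidueSymbol 𝔭 ((q : 𝓞 K ⧸ 𝔭.asIdeal) ^ 2) *
      cubicResidueSymbol 𝔮 (Ideal.Quotient.mk 𝔮.asIdeal x)) = 1 := by
    rw [map_mul, hφx, ← hχapp]
    exact_mod_cast hmain
  have hone := hroots _ hprod3 hprodφ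
  -- conclude
  rw [← hJsym]
  calc cubicResidueSymbol 𝔭 (q : 𝓞 K ⧸ 𝔭.asIdeal)
      = cubicResidueSymbol 𝔭 (q : 𝓞 K ⧸ 𝔭.asIdeal) * (cubicResidueSymbol 𝔭 ((q : 𝓞 K ⧸ 𝔭.asIdeal) ^ 2) *
          cubicResidueSymbol 𝔮 (Ideal.Quotient.mk 𝔮.asIdeal x)) := by rw [hone, mul_one]
    _ = (cubicResidueSymbol 𝔭 ((q : 𝓞 K ⧸ 𝔭.asIdeal) ^ 2) * cubicResidueSymbol 𝔭 (q : 𝓞 K ⧸ 𝔭.asIdeal)) *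
          cubicResidueSymbol 𝔮 (Ideal.Quotient.mk 𝔮.asIdeal x) := by ring
    _ = cubicResidueSymbol 𝔮 (Ideal.Quotient.mk 𝔮.asIdeal x) := by rw [hsq, one_mul]

end Reciprocity

/-! ### `J(χ_𝔭, χ_𝔭) ∈ 𝔭` -/

section JacobiSumMem

include hζ in
/-- Reduction of the values of `χ_𝔭`: `χ_𝔭(a) ≡ a^{(N𝔭-1)/3} (mod 𝔭)` for ALL `a` (for `a = 0` both
sides vanish, `(N𝔭-1)/3 ≠ 0`). [cite: IrelandRosen1982, Ch. 9 §3, Prop. 9.3.3 (b)] -/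
theorem mk_cubicResidueSymbol_eq_pow {𝔭 : HeightOneSpectrum (𝓞 K)} (h3 : (3 : 𝓞 K) ∉ 𝔭.asIdeal)
    (a : 𝓞 K ⧸ 𝔭.asIdeal) :
    Ideal.Quotient.mk 𝔭.asIdeal (cubicResidueSymbol 𝔭 a) = a ^ ((𝔭.residueCard - 1) / 3) := by
  rcases eq_or_ne a 0 with rfl | ha
  · rw [cubicResidueSymbol_zero hζ, map_zero, zero_pow (residueCard_sub_one_div_three_ne_zero hζ h3)]
  · exact (cubicResidueSymbol_spec hζ h3 ha).2

/-- The power sums `Σ_{t ∈ F} t^i` of a finite field vanish for `i < #F - 1` (Ireland–Rosen, proof of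
Lemma 1 of Ch. 9 §4: "By Exercise 11 of Chapter 4"), hence `Σ_t t^a (1 - t)^a = 0` for `2a < #F - 1`.
[folklore] -/
theorem sum_pow_mul_one_sub_pow_eq_zero {F : Type*} [Field F] [Fintype F] {a : ℕ}
    (ha : 2 * a < Fintype.card F - 1) :
    ∑ t : F, t ^ a * (1 - t) ^ a = 0 := by
  classical
  -- expand `(1 - t)^a = Σ_j C(a,j) (-t)^j`
  have hexp : ∀ t : F, t ^ a * (1 - t) ^ a =
      ∑ j ∈ Finset.range (a + 1), ((-1 : F) ^ j * (a.choose j : F)) * t ^ (a + j) := by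
    intro t
    rw [sub_eq_neg_add, add_pow, Finset.mul_sum]
    refine Finset.sum_congr rfl fun j _ ↦ ?_
    rw [one_pow, mul_one, neg_pow, pow_add]
    ring
  simp_rw [hexp]
  rw [Finset.sum_comm]
  refine Finset.sum_eq_zero fun j hj ↦ ?_
  rw [← Finset.mul_sum, FiniteField.sum_pow_lt_card_sub_one, mul_zero]
  have hj' : j ≤ a := Nat.lt_succ_iff.mp (Finset.mem_range.mp hj)
  omega

include hζ in
/-- **`J(χ_𝔭, χ_𝔭) ∈ 𝔭`** (Ireland–Rosen, proof of Lemma 1 of Ch. 9 §4: "`J(χ_π, χ_π) ≡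
Σ_x x^{(p-1)/3} (1-x)^{(p-1)/3} ≡ 0 (π)`", "the polynomial … is of degree `(2/3)(p-1) < p - 1`"); here for
any finite place `𝔭 ∤ 3`. [cite: IrelandRosen1982, Ch. 9 §4, Lemma 1 (proof)] -/
theorem cubicJacobiSum_mem (𝔭 : HeightOneSpectrum (𝓞 K)) (h3 : (3 : 𝓞 K) ∉ 𝔭.asIdeal) :
    cubicJacobiSum hζ 𝔭 h3 ∈ 𝔭.asIdeal := by
  classical
  letI := Ideal.Quotient.field 𝔭.asIdeal
  letI := Fintype.ofFinite (𝓞 K ⧸ 𝔭.asIdeal)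
  rw [← Ideal.Quotient.eq_zero_iff_mem, cubicJacobiSum_eq, jacobiSum, map_sum]
  simp_rw [map_mul, cubicResidueChar_apply, mk_cubicResidueSymbol_eq_pow hζ h3]
  refine sum_pow_mul_one_sub_pow_eq_zero ?_
  have hcard : Fintype.card (𝓞 K ⧸ 𝔭.asIdeal) = 𝔭.residueCard := by
    rw [HeightOneSpectrum.residueCard_eq_card_quotient, Nat.card_eq_fintype_card]
  have h1 := 𝔭.one_lt_residueCard
  have hdvd := three_dvd_residueCard_sub_one hζ h3 (𝔭 := 𝔭)
  rw [hcard]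
  omega

end JacobiSumMem

/-! ### `(J(χ_𝔭, χ_𝔭)) = 𝔭` over `ℚ(ω)`, and reciprocity for any generator -/

section Cyclotomic

variable [IsCyclotomicExtension {3} ℚ K]

/-- `[ℚ(ω) : ℚ] = 2`. [folklore] -/
theorem finrank_eq_two_of_isCyclotomicExtension_three : Module.finrank ℚ K = 2 := by
  rw [IsCyclotomicExtension.finrank (n := 3) K (Polynomial.cyclotomic.irreducible_rat (by norm_num))]
  decide

include hζ in
/-- **The non-trivial automorphism of `ℚ(ω)` squares the cube roots of unity and fixes `0`**: there is
`σ : K ≃ₐ[ℚ] K`, `σ ≠ 1`, with `σ μ = μ²` for every `μ ∈ 𝓞 K` which is `0` or a cube root of unity —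
in particular on all values of `χ_𝔭`. [folklore] -/
theorem exists_aut_apply_eq_sq :
    ∃ σ : K ≃ₐ[ℚ] K, σ ≠ 1 ∧ ∀ μ : 𝓞 K, (μ = 0 ∨ μ ^ 3 = 1) →
      σ (algebraMap (𝓞 K) K μ) = algebraMap (𝓞 K) K (μ ^ 2) := by
  set e := IsCyclotomicExtension.Rat.galEquivZMod 3 K with he
  set σ : K ≃ₐ[ℚ] K := e.symm (-1) with hσ
  have hval : ((e σ : (ZMod 3)ˣ) : ZMod 3).val = 2 := by
    rw [hσ, MulEquiv.apply_symm_apply]; decide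
  have hsq : ∀ x : K, x ^ 3 = 1 → σ x = x ^ 2 := fun x hx ↦ by
    rw [IsCyclotomicExtension.Rat.galEquivZMod_apply_of_pow_eq 3 K σ hx, ← he, hval]
  have hζK : IsPrimitiveRoot (algebraMap (𝓞 K) K ζ) 3 :=
    hζ.map_of_injective (FaithfulSMul.algebraMap_injective (𝓞 K) K)
  refine ⟨σ, ?_, ?_⟩
  · intro h1
    have h := hsq _ hζK.pow_eq_one
    rw [h1, AlgEquiv.one_apply] at h
    have h2 : algebraMap (𝓞 K) K ζ ^ 2 = algebraMap (𝓞 K) K ζ ^ 1 := by rw [pow_one]; exact h.symm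
    have := hζK.pow_inj (by norm_num) (by norm_num) h2
    omega
  · rintro μ (rfl | hμ)
    · simp
    · rw [map_pow]
      exact hsq _ (by rw [← map_pow, hμ, map_one])

include hζ in
/-- **`J(χ_𝔭, χ_𝔭)` generates `𝔭`** in `ℤ[ω]` (Ireland–Rosen Ch. 9 §4, Lemma 1: "`J(χ_π, χ_π) = π`" for
`π` primary; its proof — "`π π̄ = p = π' π̄'`" with `π' = J(χ_π, χ_π)`, and "`π ∣ π'`" — shows that
`J(χ_π, χ_π)` is an associate of `π` without any normalisation, which is the statement here): for
`K = ℚ(ω)` and every finite place `𝔭 ∤ 3`, `(J(χ_𝔭, χ_𝔭)) = 𝔭`. Proof: `J ∈ 𝔭`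
(`cubicJacobiSum_mem`); `J · J(χ², χ²) = N𝔭` (Mathlib's `jacobiSum_mul_jacobiSum_inv`); the
non-trivial automorphism `σ` maps `J` to `J(χ², χ²)` (it squares the values), so
`N_{K/ℚ}(J) = J σ(J) = N𝔭 = N(𝔭)`, and an ideal divisible by `𝔭` with the same norm is `𝔭`.
[cite: IrelandRosen1982, Ch. 9 §4, Lemma 1 (proof)] -/
theorem span_cubicJacobiSum_eq (𝔭 : HeightOneSpectrum (𝓞 K)) (h3 : (3 : 𝓞 K) ∉ 𝔭.asIdeal) :
    Ideal.span {cubicJacobiSum hζ 𝔭 h3} = 𝔭.asIdeal := by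
  classical
  letI := Ideal.Quotient.field 𝔭.asIdeal
  letI := Fintype.ofFinite (𝓞 K ⧸ 𝔭.asIdeal)
  haveI : IsGalois ℚ K := IsCyclotomicExtension.isGalois {3} ℚ K
  set χ₀ := cubicResidueChar hζ 𝔭 h3 with hχ₀def
  set J := cubicJacobiSum hζ 𝔭 h3 with hJdef
  set J₂ : 𝓞 K := jacobiSum (χ₀ ^ 2) (χ₀ ^ 2) with hJ₂def
  -- (1) `J * J₂ = N𝔭` in `𝓞 K`, from Mathlib's identity in the field `K`
  have hcardF : Fintype.card (𝓞 K ⧸ 𝔭.asIdeal) = 𝔭.residueCard := by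
    rw [HeightOneSpectrum.residueCard_eq_card_quotient, Nat.card_eq_fintype_card]
  have hχ3 : χ₀ ^ 3 = 1 := cubicResidueChar_pow_three hζ h3
  have hχne : χ₀ ≠ 1 := by
    intro h1
    obtain ⟨g, hg⟩ := IsCyclic.exists_generator (α := (𝓞 K ⧸ 𝔭.asIdeal)ˣ)
    have hspec := (cubicResidueSymbol_spec hζ h3 (Units.ne_zero g)).2
    have hg1 : cubicResidueSymbol 𝔭 (g : 𝓞 K ⧸ 𝔭.asIdeal) = 1 := by
      have := congrArg (fun χ' : MulChar (𝓞 K ⧸ 𝔭.asIdeal) (𝓞 K) ↦ χ' (g : 𝓞 K ⧸ 𝔭.asIdeal)) h1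
      simpa only [hχ₀def, cubicResidueChar_apply, MulChar.one_apply_coe] using this
    rw [hg1, map_one] at hspec
    have hord : orderOf g = Fintype.card (𝓞 K ⧸ 𝔭.asIdeal) - 1 := by
      rw [orderOf_eq_card_of_forall_mem_zpowers hg, Nat.card_eq_fintype_card, Fintype.card_units]
    have hdvd := orderOf_dvd_of_pow_eq_one (x := g) (n := (𝔭.residueCard - 1) / 3)
      (Units.ext (by rw [Units.val_pow_eq_pow_val, Units.val_one, ← hspec]))
    rw [hord, hcardF] at hdvd
    have hpos := residueCard_sub_one_div_three_ne_zero hζ h3 (𝔭 := 𝔭)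
    have h3dvd := three_dvd_residueCard_sub_one hζ h3 (𝔭 := 𝔭)
    have hle := Nat.le_of_dvd (Nat.pos_of_ne_zero hpos) hdvd
    omega
  have hordχ : orderOf χ₀ = 3 := orderOf_eq_prime hχ3 hχne
  have hprod : J * J₂ = (𝔭.residueCard : 𝓞 K) := by
    apply FaithfulSMul.algebraMap_injective (𝓞 K) K
    set ι := algebraMap (𝓞 K) K with hι
    have hιinj : Function.Injective ι := FaithfulSMul.algebraMap_injective (𝓞 K) K
    set χK : MulChar (𝓞 K ⧸ 𝔭.asIdeal) K := χ₀.ringHomComp ι with hχK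
    have hχK3 : χK ^ 3 = 1 := by rw [hχK, MulChar.ringHomComp_pow, hχ3, MulChar.ringHomComp_one]
    have hχKne : χK ≠ 1 := by
      intro h1
      apply hχne
      refine MulChar.ext fun u ↦ ?_
      have h2 : ι (χ₀ (u : 𝓞 K ⧸ 𝔭.asIdeal)) = 1 := by
        have := congrArg (fun χ' : MulChar (𝓞 K ⧸ 𝔭.asIdeal) K ↦ χ' (u : 𝓞 K ⧸ 𝔭.asIdeal)) h1
        simpa only [hχK, MulChar.ringHomComp_apply, MulChar.one_apply_coe] using this
      rw [MulChar.one_apply_coe]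
      exact hιinj (h2.trans (map_one ι).symm)
    have hordK : orderOf χK = 3 := orderOf_eq_prime hχK3 hχKne
    have hχK2ne : χK * χK ≠ 1 := by
      rw [← sq]
      exact pow_ne_one_of_lt_orderOf two_ne_zero (by rw [hordK]; norm_num)
    have hinv : χK⁻¹ = χK ^ 2 := inv_eq_of_mul_eq_one_right (by rw [← pow_succ', hχK3])
    have hchar : ringChar K ≠ ringChar (𝓞 K ⧸ 𝔭.asIdeal) := by
      rw [ringChar.eq_zero]
      exact (CharP.char_ne_zero_of_finite (𝓞 K ⧸ 𝔭.asIdeal) _).symm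
    have h := jacobiSum_mul_jacobiSum_inv hchar hχKne hχKne hχK2ne
    rw [hinv, hχK, MulChar.ringHomComp_pow, jacobiSum_ringHomComp, jacobiSum_ringHomComp,
      ← map_mul, hcardF] at h
    rw [map_natCast, hJdef, cubicJacobiSum_eq, hJ₂def]
    exact h
  -- (2) the non-trivial automorphism maps `J` to `J₂`
  obtain ⟨σ, hσ1, hσ⟩ := exists_aut_apply_eq_sq hζ
  have hσJ : σ (algebraMap (𝓞 K) K J) = algebraMap (𝓞 K) K J₂ := by
    rw [hJdef, cubicJacobiSum_eq, hJ₂def, jacobiSum, jacobiSum, map_sum, map_sum, map_sum]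
    refine Finset.sum_congr rfl fun t _ ↦ ?_
    have hv : ∀ a : 𝓞 K ⧸ 𝔭.asIdeal,
        σ (algebraMap (𝓞 K) K (χ₀ a)) = algebraMap (𝓞 K) K ((χ₀ ^ 2) a) := by
      intro a
      rw [MulChar.pow_apply' χ₀ two_ne_zero]
      refine hσ _ ?_
      rw [hχ₀def, cubicResidueChar_apply]
      rcases cubicResidueSymbol_eq_zero_or_pow_three hζ 𝔭 a with h0 | h1
      · exact Or.inl h0
      · exact Or.inr h1
    rw [map_mul, map_mul, map_mul, hv, hv]
  -- (3) the norm of `J` is `N𝔭`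
  have hcard2 : Fintype.card (K ≃ₐ[ℚ] K) = 2 := by
    rw [← Nat.card_eq_fintype_card, IsGalois.card_aut_eq_finrank,
      finrank_eq_two_of_isCyclotomicExtension_three]
  have huniv : (Finset.univ : Finset (K ≃ₐ[ℚ] K)) = {1, σ} := by
    symm
    apply Finset.eq_univ_of_card
    rw [Finset.card_pair hσ1.symm, hcard2]
  have hnormQ : Algebra.norm ℚ (algebraMap (𝓞 K) K J) = (𝔭.residueCard : ℚ) := by
    apply (algebraMap ℚ K).injective
    rw [Algebra.norm_eq_prod_automorphisms, huniv, Finset.prod_pair hσ1.symm, AlgEquiv.one_apply, hσJ,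
      map_natCast, ← map_mul, hprod, map_natCast]
  have hnormZ : Algebra.norm ℤ J = (𝔭.residueCard : ℤ) := by
    have h := Algebra.coe_norm_int J
    rw [show ((J : 𝓞 K) : K) = algebraMap (𝓞 K) K J from rfl, hnormQ] at h
    exact_mod_cast h
  have habs : Ideal.absNorm (Ideal.span {J}) = 𝔭.residueCard := by
    rw [Ideal.absNorm_span_singleton, hnormZ, Int.natAbs_natCast]
  -- (4) conclude: `𝔭 ∣ (J)` with equal norms
  have hle : Ideal.span {J} ≤ 𝔭.asIdeal := by
    rw [Ideal.span_singleton_le_iff_mem]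
    exact cubicJacobiSum_mem hζ 𝔭 h3
  obtain ⟨𝔠, h𝔠⟩ := Ideal.dvd_iff_le.mpr hle
  have hnorm𝔠 : Ideal.absNorm 𝔠 = 1 := by
    have h := congrArg Ideal.absNorm h𝔠
    rw [map_mul, habs, HeightOneSpectrum.residueCard] at h
    have h0 : Ideal.absNorm 𝔭.asIdeal ≠ 0 := Ideal.absNorm_eq_zero_iff.not.mpr 𝔭.ne_bot
    exact (mul_right_eq_self₀.mp h.symm).resolve_right h0
  rw [h𝔠, Ideal.absNorm_eq_one_iff.mp hnorm𝔠, Ideal.mul_top]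

include hζ in
/-- **Units of `ℤ[ω]` are cubes modulo `𝔮` when `9 ∣ N𝔮 - 1`**: `χ_𝔮(u) = 1` for every unit `u`
(the units are `±ω^i`, `χ_𝔮(-1) = 1` always and `χ_𝔮(ω) = ω^{(N𝔮-1)/3} = 1`). [folklore] -/
theorem cubicResidueSymbol_unit_eq_one {𝔮 : HeightOneSpectrum (𝓞 K)} (h3 : (3 : 𝓞 K) ∉ 𝔮.asIdeal)
    (h9 : 9 ∣ 𝔮.residueCard - 1) (u : (𝓞 K)ˣ) :
    cubicResidueSymbol 𝔮 (Ideal.Quotient.mk 𝔮.asIdeal u) = 1 := by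
  have hζK : IsPrimitiveRoot (ζ : K) 3 := hζ.map_of_injective (FaithfulSMul.algebraMap_injective (𝓞 K) K)
  have hint : hζK.toInteger = ζ := Subtype.ext rfl
  -- `χ_𝔮(-1) = 1` and `χ_𝔮(ζ) = 1`
  have hneg : cubicResidueSymbol 𝔮 (Ideal.Quotient.mk 𝔮.asIdeal (-1)) = 1 := by
    have hne : Ideal.Quotient.mk 𝔮.asIdeal (-1 : 𝓞 K) ≠ 0 := by
      rw [map_neg, map_one, neg_ne_zero]
      letI := Ideal.Quotient.field 𝔮.asIdeal
      exact one_ne_zero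
    obtain ⟨h1, -⟩ := cubicResidueSymbol_spec hζ h3 hne
    have hcube : (Ideal.Quotient.mk 𝔮.asIdeal (-1 : 𝓞 K)) ^ 3 = Ideal.Quotient.mk 𝔮.asIdeal (-1 : 𝓞 K) := by
      rw [← map_pow]; norm_num
    -- `χ(-1) = χ((-1)³) = χ(-1)³ = 1`
    calc cubicResidueSymbol 𝔮 (Ideal.Quotient.mk 𝔮.asIdeal (-1))
        = cubicResidueSymbol 𝔮 ((Ideal.Quotient.mk 𝔮.asIdeal (-1)) ^ 3) := by rw [hcube]
      _ = cubicResidueSymbol 𝔮 (Ideal.Quotient.mk 𝔮.asIdeal (-1)) ^ 3 := by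
          rw [← cubicResidueChar_apply hζ h3, map_pow, cubicResidueChar_apply]
      _ = 1 := h1
  have hzeta : cubicResidueSymbol 𝔮 (Ideal.Quotient.mk 𝔮.asIdeal ζ) = 1 := by
    refine cubicResidueSymbol_eq_of_pow_three_eq_one hζ h3 (one_pow 3) ?_
    obtain ⟨m, hm⟩ := h9
    have hexp : (𝔮.residueCard - 1) / 3 = 3 * m := by omega
    rw [map_one, hexp, pow_mul, ← map_pow, hζ.pow_eq_one, map_one, one_pow]
  -- the list of units
  have hmem := IsCyclotomicExtension.Rat.Three.Units.mem hζK u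
  simp only [List.mem_cons, List.not_mem_nil, or_false] at hmem
  have hη : ((IsPrimitiveRoot.isUnit (hζK.toInteger_isPrimitiveRoot) (by decide)).unit : 𝓞 K) = ζ := by
    rw [IsUnit.unit_spec, hint]
  rcases hmem with h | h | h | h | h | h <;> rw [h]
  · rw [Units.val_one, map_one]; exact cubicResidueSymbol_one hζ h3
  · rw [Units.val_neg, Units.val_one]; exact hneg
  · rw [hη]; exact hzeta
  · rw [Units.val_neg, hη, neg_eq_neg_one_mul, map_mul, cubicResidueSymbol_mul hζ, hneg, hzeta, one_mul]
  · rw [Units.val_pow_eq_pow_val, hη, map_pow, ← cubicResidueChar_apply hζ h3, map_pow,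
      cubicResidueChar_apply, hzeta, one_pow]
  · rw [Units.val_neg, Units.val_pow_eq_pow_val, hη, neg_eq_neg_one_mul, map_mul,
      cubicResidueSymbol_mul hζ, hneg, one_mul, map_pow, ← cubicResidueChar_apply hζ h3, map_pow,
      cubicResidueChar_apply, hzeta, one_pow]

include hζ in
/-- **Cubic reciprocity with a rational prime `q ≡ 8 (mod 9)`, for any generator** (Eisenstein;
Ireland–Rosen Ch. 9 Thm. 1, mixed case, freed of the primary normalisation because every unit of
`ℤ[ω]` is a cubic residue modulo such `q`): for `K = ℚ(ω)`, a rational prime `q ≡ 8 (mod 9)`, a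
finite place `𝔮 ∋ q` with `N𝔮 = q²`, and a principal finite place `𝔭 = (π) ∤ 3q`,
`χ_𝔭(q) = χ_𝔮(π)` — "`(q/π)₃ = (π/q)₃`". [cite: IrelandRosen1982, Ch. 9 §3 Theorem 1 with §4 (proof, case π₁ = q)] -/
theorem cubicResidueSymbol_natCast_eq_cubicResidueSymbol_generator {q : ℕ} [Fact q.Prime]
    (hq9 : q % 9 = 8) {𝔮 : HeightOneSpectrum (𝓞 K)} (hq𝔮 : (q : 𝓞 K) ∈ 𝔮.asIdeal)
    (h𝔮 : 𝔮.residueCard = q ^ 2) {𝔭 : HeightOneSpectrum (𝓞 K)} (h3 : (3 : 𝓞 K) ∉ 𝔭.asIdeal)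
    (hq𝔭 : (q : 𝓞 K) ∉ 𝔭.asIdeal) {π : 𝓞 K} (hπ : 𝔭.asIdeal = Ideal.span {π}) :
    cubicResidueSymbol 𝔭 (q : 𝓞 K ⧸ 𝔭.asIdeal) = cubicResidueSymbol 𝔮 (Ideal.Quotient.mk 𝔮.asIdeal π) := by
  have hq3 : q % 3 = 2 := by omega
  rw [cubicResidueSymbol_natCast_eq_cubicResidueSymbol_cubicJacobiSum hζ hq3 hq𝔮 h𝔮 h3 hq𝔭]
  -- `J = π u` for a unit `u`
  have hspan : Ideal.span {cubicJacobiSum hζ 𝔭 h3} = Ideal.span {π} := by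
    rw [span_cubicJacobiSum_eq hζ 𝔭 h3, hπ]
  obtain ⟨u, hu⟩ := Ideal.span_singleton_eq_span_singleton.mp hspan.symm
  have hq3' : Nat.Coprime q 3 := by
    rw [Nat.coprime_comm, Nat.Prime.coprime_iff_not_dvd (by norm_num)]
    omega
  have h3𝔮 : (3 : 𝓞 K) ∉ 𝔮.asIdeal := three_not_mem_of_natCast_mem hq𝔮 hq3'
  have h9 : 9 ∣ 𝔮.residueCard - 1 := by
    rw [h𝔮, ← Nat.modEq_iff_dvd' (Nat.one_le_pow _ _ (Nat.pos_of_ne_zero (by omega))), Nat.ModEq,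
      Nat.pow_mod, hq9]
  rw [← hu, map_mul, cubicResidueSymbol_mul hζ, cubicResidueSymbol_unit_eq_one hζ h3𝔮 h9 u, mul_one]

end Cyclotomic

end Literature.NumberTheory.GaloisRepresentations
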